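import Summits.CriticalPhenomena.PercolationContinuityZ3.Theorems.PercNearOneGluingNoHeavyLowerTailTwoCopyFibre
import HarnessLib

/-!
# Two-copy certificates: a FAST fibre checker (`twoCopyCheckFast`) equal to `TwoCopy.twoCopyCheck`

builds on p205010 (kernel theorem, internal audit signed; external expert review pending)

Support file (`--supports stmt-CriticalPhenomena-4575`), seat `prim-cert-1` (gen 18).  `TwoCopy.twoCopyCheck m K t h a b`
(`…TwoCopyFibre`) decides the nonnegativity of every fibre coefficient of a bidegree-2 Bernstein certificate; its fibre sum
`TwoCopy.fib m G S₂ S₁ = Σ_{T ⊆ S₁} G(S₂ ∪ T, S₂ ∪ (S₁ ∖ T))` FILTERS all `2^m` masks for the sub-masks of `S₁`, so one evaluation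
costs `O(3^m · 2^m)` — fine for `m ≤ 10` (`K₅`), too slow from `m = 11` on (the sun graphs `C_{K+1}` with `K ≥ 5` hairs of
`…QuantFarSunCert`, `m = 2K + 1`).  Here the sub-masks are enumerated by recursion on the list of bits of `S₁` (`subSumL`,
`O(2^{|S₁|})`, total `O(4^m)`), and the resulting checker is proved EQUAL to `twoCopyCheck`, so every soundness theorem stated for
`twoCopyCheck` applies verbatim (`rw [← twoCopyCheckFast_eq]; native_decide`).

* `subSumL f bs acc` — `Σ_{T ⊆ mask(bs)} f (acc ∪ T)` by recursion on the bit list;  `subSumL_eq_sum` — equals the filtered sum.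
* `fibFast`, `fibFast_eq` (`= fib` for `S₁ < 2^m`);  `twoCopyCheckFast`, `twoCopyCheckFast_eq` (`= twoCopyCheck`).
No sorries; standard axioms; nothing here asserts anything about the crux.
-/

namespace Summit.CriticalPhenomena.PercolationContinuityZ3.Theorems.TwoCopy

open Finset

/-! ## Sub-mask sums by recursion on the bits -/

/-- `Σ_{T ⊆ mask(bs)} f (acc ||| T)`, by recursion on the list `bs` of bit positions. [this work] -/
def subSumL (f : ℕ → ℤ) : List ℕ → ℕ → ℤ
  | [], acc => f acc
  | b :: bs, acc => subSumL f bs acc + subSumL f bs (acc ||| 2 ^ b)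

/-- The mask with the listed bits set. [this work] -/
def maskOf : List ℕ → ℕ
  | [] => 0
  | b :: bs => maskOf bs ||| 2 ^ b

/-- The list of set bits of `U` below `m`. [this work] -/
def bitsOf (m U : ℕ) : List ℕ := (List.range m).filter fun b => U.testBit b

/-- Bits of `maskOf`. [this work] -/
theorem testBit_maskOf (bs : List ℕ) (i : ℕ) : (maskOf bs).testBit i = decide (i ∈ bs) := by
  induction bs with
  | nil => simp [maskOf]
  | cons b bs ih =>
    simp only [maskOf, Nat.testBit_or, ih, Nat.testBit_two_pow, List.mem_cons]
    rcases eq_or_ne b i with rfl | hne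
    · simp
    · simp [hne, hne.symm]

/-- `maskOf (bitsOf m U) = U` for `U < 2^m`. [this work] -/
theorem maskOf_bitsOf {m U : ℕ} (hU : U < 2 ^ m) : maskOf (bitsOf m U) = U := by
  refine Nat.eq_of_testBit_eq fun i => ?_
  rw [testBit_maskOf]
  unfold bitsOf
  simp only [List.mem_filter, List.mem_range]
  by_cases hi : i < m
  · cases h : U.testBit i <;> simp [hi]
  · have hU' : U < 2 ^ i := lt_of_lt_of_le hU (Nat.pow_le_pow_right (by norm_num) (not_lt.1 hi))
    simp [hi, Nat.testBit_lt_two_pow hU']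

/-- Sub-mask as a bitwise implication. [folklore] -/
theorem and_eq_self_iff (T U : ℕ) : T &&& U = T ↔ ∀ i, T.testBit i = true → U.testBit i = true := by
  constructor
  · intro h i hT
    have := congrArg (fun n => n.testBit i) h
    simp only [Nat.testBit_and, hT, Bool.true_and] at this
    exact this
  · intro h
    refine Nat.eq_of_testBit_eq fun i => ?_
    rw [Nat.testBit_and]
    cases hT : T.testBit i
    · simp
    · simp [h i hT]

/-- `acc ||| (T ||| B) = (acc ||| B) ||| T`. [folklore] -/
theorem or_or_comm3 (acc T B : ℕ) : acc ||| (T ||| B) = (acc ||| B) ||| T := by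
  refine Nat.eq_of_testBit_eq fun i => ?_
  simp only [Nat.testBit_or]
  cases acc.testBit i <;> cases T.testBit i <;> cases B.testBit i <;> rfl

/-- **The recursion computes the filtered sub-mask sum.** [this work] -/
theorem subSumL_eq_sum (m : ℕ) (f : ℕ → ℤ) : ∀ (bs : List ℕ), bs.Nodup → (∀ b ∈ bs, b < m) → ∀ acc : ℕ,
    subSumL f bs acc = ∑ T ∈ (range (2 ^ m)).filter (fun T => T &&& maskOf bs = T), f (acc ||| T) := by
  intro bs
  induction bs with
  | nil =>
    intro _ _ acc
    have hset : (range (2 ^ m)).filter (fun T => T &&& maskOf [] = T) = {0} := by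
      ext T
      simp only [maskOf, Nat.and_zero, mem_filter, mem_range, mem_singleton]
      constructor
      · rintro ⟨-, h⟩; exact h.symm
      · rintro rfl; exact ⟨Nat.pos_of_ne_zero (by positivity), rfl⟩
    rw [hset, sum_singleton]
    simp [subSumL]
  | cons b bs ih =>
    intro hnd hlt acc
    rw [List.nodup_cons] at hnd
    obtain ⟨hb, hnd'⟩ := hnd
    have hltb : b < m := hlt b (by simp)
    have h2b : 2 ^ b < 2 ^ m := Nat.pow_lt_pow_right (by norm_num) hltb
    have hlt' : ∀ b' ∈ bs, b' < m := fun b' hb' => hlt b' (List.mem_cons_of_mem _ hb')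
    have hU'b : (maskOf bs).testBit b = false := by
      rw [testBit_maskOf]; simp [hb]
    have hUbit : ∀ i, (maskOf (b :: bs)).testBit i = ((maskOf bs).testBit i || decide (b = i)) := fun i => by
      simp only [maskOf, Nat.testBit_or, Nat.testBit_two_pow]
    have hPiff : ∀ T, T &&& maskOf (b :: bs) = T ↔
        ∀ i, T.testBit i = true → ((maskOf bs).testBit i || decide (b = i)) = true := fun T => by
      rw [and_eq_self_iff]; simp only [hUbit]
    have hP'iff : ∀ T, T &&& maskOf bs = T ↔ ∀ i, T.testBit i = true → (maskOf bs).testBit i = true := fun T =>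
      and_eq_self_iff T (maskOf bs)
    -- split the filter along bit `b`
    have hsplit := (sum_filter_add_sum_filter_not ((range (2 ^ m)).filter (fun T => T &&& maskOf (b :: bs) = T))
      (fun T => T.testBit b = true) (fun T => f (acc ||| T))).symm
    rw [show subSumL f (b :: bs) acc = subSumL f bs acc + subSumL f bs (acc ||| 2 ^ b) from rfl, hsplit,
      ih hnd' hlt' acc, ih hnd' hlt' (acc ||| 2 ^ b), add_comm]
    congr 1
    · -- bit `b` set: the images `T' ||| 2^b` of the sub-masks `T'` of `maskOf bs`
      have himg : ((range (2 ^ m)).filter (fun T => T &&& maskOf (b :: bs) = T)).filter (fun T => T.testBit b = true) =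
          ((range (2 ^ m)).filter (fun T => T &&& maskOf bs = T)).image (fun T' => T' ||| 2 ^ b) := by
        ext T
        simp only [mem_filter, mem_range, mem_image]
        constructor
        · rintro ⟨⟨hT, hPT⟩, hTb⟩
          refine ⟨T ^^^ 2 ^ b, ⟨Nat.xor_lt_two_pow hT h2b, (hP'iff _).2 fun i hi => ?_⟩, ?_⟩
          · rw [Nat.testBit_xor, Nat.testBit_two_pow] at hi
            by_cases hbi : b = i
            · subst hbi; rw [hTb] at hi; simp at hi
            · have hTi : T.testBit i = true := by simpa [hbi] using hi
              have := (hPiff T).1 hPT i hTi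
              simpa [hbi] using this
          · refine Nat.eq_of_testBit_eq fun i => ?_
            rw [Nat.testBit_or, Nat.testBit_xor, Nat.testBit_two_pow]
            by_cases hbi : b = i
            · subst hbi; rw [hTb]; simp
            · simp [hbi]
        · rintro ⟨T', ⟨hT', hP'T'⟩, rfl⟩
          refine ⟨⟨Nat.or_lt_two_pow hT' h2b, (hPiff _).2 fun i hi => ?_⟩, ?_⟩
          · rw [Nat.testBit_or, Nat.testBit_two_pow] at hi
            by_cases hbi : b = i
            · simp [hbi]
            · have hTi : T'.testBit i = true := by simpa [hbi] using hi
              rw [(hP'iff T').1 hP'T' i hTi]; rfl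
          · rw [Nat.testBit_or, Nat.testBit_two_pow]; simp
      rw [himg, sum_image]
      · refine sum_congr rfl fun T' _ => ?_
        rw [or_or_comm3]
      · -- injectivity on the sub-masks of `maskOf bs` (their bit `b` is clear)
        intro T1 hT1 T2 hT2 heq
        rw [coe_filter, Set.mem_setOf_eq] at hT1 hT2
        have hc1 : T1.testBit b = false := by
          cases h : T1.testBit b
          · rfl
          · have := (hP'iff T1).1 hT1.2 b h; rw [hU'b] at this; exact absurd this Bool.false_ne_true
        have hc2 : T2.testBit b = false := by
          cases h : T2.testBit b
          · rfl
          · have := (hP'iff T2).1 hT2.2 b h; rw [hU'b] at this; exact absurd this Bool.false_ne_true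
        refine Nat.eq_of_testBit_eq fun i => ?_
        have := congrArg (fun n => n.testBit i) heq
        simp only [Nat.testBit_or, Nat.testBit_two_pow] at this
        by_cases hbi : b = i
        · subst hbi; rw [hc1, hc2]
        · simpa [hbi] using this
    · -- bit `b` clear: exactly the sub-masks of `maskOf bs`
      refine sum_congr ?_ fun _ _ => rfl
      ext T
      simp only [mem_filter, mem_range]
      constructor
      · rintro ⟨hT, hP'T⟩
        refine ⟨⟨hT, (hPiff T).2 fun i hi => by rw [(hP'iff T).1 hP'T i hi]; rfl⟩, ?_⟩
        intro hTb
        have := (hP'iff T).1 hP'T b hTb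
        rw [hU'b] at this
        exact Bool.false_ne_true this
      · rintro ⟨⟨hT, hPT⟩, hTb⟩
        refine ⟨hT, (hP'iff T).2 fun i hi => ?_⟩
        have h1 := (hPiff T).1 hPT i hi
        rw [Bool.or_eq_true] at h1
        rcases h1 with h | h
        · exact h
        · exfalso
          have hib : b = i := of_decide_eq_true h
          subst hib
          exact hTb hi

/-! ## The fast fibre sum and the fast checker -/

/-- Fast fibre coefficient: `Σ_{T ⊆ S₁} G(S₂ ∪ T, S₂ ∪ (S₁ ∖ T))` by sub-mask recursion. [this work] -/
def fibFast (m : ℕ) (G : ℕ → ℕ → ℤ) (S2 S1 : ℕ) : ℤ :=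
  subSumL (fun T => G (S2 ||| T) (S2 ||| (S1 ^^^ T))) (bitsOf m S1) 0

/-- `fibFast = fib` below `2^m`. [this work] -/
theorem fibFast_eq (m : ℕ) (G : ℕ → ℕ → ℤ) (S2 : ℕ) {S1 : ℕ} (hS1 : S1 < 2 ^ m) :
    fibFast m G S2 S1 = fib m G S2 S1 := by
  unfold fibFast fib
  have hnd : (bitsOf m S1).Nodup := (List.nodup_range).filter _
  have hlt : ∀ b ∈ bitsOf m S1, b < m := fun b hb => by
    unfold bitsOf at hb
    exact List.mem_range.1 (List.mem_filter.1 hb).1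
  rw [subSumL_eq_sum m _ (bitsOf m S1) hnd hlt 0, maskOf_bitsOf hS1]
  refine sum_congr rfl fun T _ => ?_
  rw [Nat.zero_or]

/-- THE FAST CHECK: same verdict as `twoCopyCheck`, fibre sums by sub-mask recursion. [this work] -/
def twoCopyCheckFast (m K : ℕ) (t : ℕ → ℕ → ℤ) (h : ℕ → ℤ) (a : ℕ → ℕ → ℕ) (b : ℕ → ℕ) : Bool :=
  (List.range (2 ^ m)).all fun S1 => (List.range (2 ^ m)).all fun S2 =>
    (S2 &&& S1 != 0) || decide (0 ≤ fibFast m (pairing K t h a b) S2 S1)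

/-- **`twoCopyCheckFast = twoCopyCheck`.** [this work] -/
theorem twoCopyCheckFast_eq (m K : ℕ) (t : ℕ → ℕ → ℤ) (h : ℕ → ℤ) (a : ℕ → ℕ → ℕ) (b : ℕ → ℕ) :
    twoCopyCheckFast m K t h a b = twoCopyCheck m K t h a b := by
  unfold twoCopyCheckFast twoCopyCheck
  rw [Bool.eq_iff_iff]
  simp only [List.all_eq_true, List.mem_range]
  constructor
  · intro H S1 hS1 S2 hS2
    have := H S1 hS1 S2 hS2
    rwa [fibFast_eq m _ S2 hS1] at this
  · intro H S1 hS1 S2 hS2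
    have := H S1 hS1 S2 hS2
    rwa [← fibFast_eq m _ S2 hS1] at this

end Summit.CriticalPhenomena.PercolationContinuityZ3.Theorems.TwoCopy
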